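import Summits.AnomalousDissipation.AnomalousDissipation.Theorems.SteadyCoherentFractionRootsPlanarWitnessDefect
import Literature.Analysis.FunctionSpaces.TorusSobolevSpaceProofs
import Literature.Analysis.FunctionSpaces.TorusFluidGlueProofs
import Literature.Analysis.FluidPDE.NSStrongSolutions2DProofs
import Literature.Analysis.FluidPDE.StatisticalSolutionDirac
import Summits.AnomalousDissipation.AnomalousDissipation.Theses.SteadyCoherentFraction

/-!
# `RootsPlanar` (stmt-AnomalousDissipation-28522, route SteadyCoherentFraction rank 3) is FALSE

The crossed-shear fluctuation `v` (`…WitnessDefs/Field/Root/Defect`) represents a state `W ∈ V ⊂ H` (`exists_state`);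
testing the classical equation `(v·∇)v + Dv·m + ∇p = f_K` against any smooth solenoidal `w` and moving the derivatives onto
`w` (antisymmetry of the trilinear form, `∫⟪∇p, w⟫ = 0`) gives the cylindrical steady-root identity of the crux with drift
`m = c_K e₁` (`root_identity`); the a.e. class has the defect of `v` (translation invariance of Haar measure), `≥ c_K²/16 > 0`
for EVERY lattice direction, so the infimum in `RootsPlanar` cannot vanish: `not_rootsPlanar : ¬RootsPlanar`.
Class: refuted-SUBSTANTIVE (the load-bearing inviscid Liouville claim is false for a smooth one-parameter-profile family
through the laminar root; the finite-mode repair is the separate item `FiniteModeRootsPlanar` 27870, untouched — the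
witness has infinite Fourier type). Census E31 (decomp-ad STATUS 2026-08-30T23:16:46Z), crit-certified on paper l.1223,
lens-4 g22 independent kernel spec `CrossedShearRoots.lean` a0e7b9766f80b4f9.
-/

noncomputable section

-- `Summit.<Summit>.<Problem>` is the tree's mandated summit-side namespace (CONVENTIONS §2); for this
-- single-conjunct summit the two segments coincide, so the duplicate is deliberate.
set_option linter.dupNamespace false

namespace Summit.AnomalousDissipation.AnomalousDissipation.Theorems.CrossedShearRoot

open Real MeasureTheory
open scoped InnerProductSpace
open Literature.Analysis.FunctionSpaces Literature.Analysis.FunctionSpaces.Torus Literature.Analysis.FluidPDE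

/-! ## §10 The state in `H`, the cylindrical root identity -/

/-- `v` represents a state of the energy space `H`, of finite enstrophy (`V`). [folklore] -/
theorem exists_state :
    ∃ W : Literature.Analysis.FunctionSpaces.Torus.energySpace (Fin 3),
      ((W : Lp (EuclideanSpace ℝ (Fin 3)) 2 (volume : Measure (UnitAddTorus (Fin 3)))) : (UnitAddTorus (Fin 3)) → (EuclideanSpace ℝ (Fin 3))) =ᵐ[volume] vfield ∧
        (W : Lp (EuclideanSpace ℝ (Fin 3)) 2 (volume : Measure (UnitAddTorus (Fin 3)))) ∈ Literature.Analysis.FunctionSpaces.Torus.energySpaceV (Fin 3) := by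
  have hmem : (isSmooth_vfield.memLp 2).toLp vfield ∈ Torus.smoothSolenoidal (Fin 3) :=
    ⟨vfield, isSmooth_vfield, isDivFree_vfield, hasZeroMean_vfield, MemLp.coeFn_toLp (isSmooth_vfield.memLp 2)⟩
  exact ⟨⟨(isSmooth_vfield.memLp 2).toLp vfield, Torus.smoothSolenoidal_subset_energySpace hmem⟩,
    MemLp.coeFn_toLp (isSmooth_vfield.memLp 2), Torus.smoothSolenoidal_subset_energySpaceV_holds hmem⟩

/-- A constant field is divergence free. [folklore] -/
theorem isDivFree_const_field (c : (EuclideanSpace ℝ (Fin 3))) : IsDivFree (fun _ : (UnitAddTorus (Fin 3)) => c) := by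
  intro x
  unfold divergence
  simp [Torus.partialDeriv, Torus.lineDeriv]

/-- **The cylindrical root identity.** For every state `W` represented by `v` and every smooth
divergence-free test field `w`: `(f_K, w) + (W, (m·∇)w) + ∫⟪(W·∇)w, W⟫ = 0` with `m = c_K e₁`
(test the classical equation `(v·∇)v + Dv·m + ∇p = f_K` against `w`, move all derivatives onto `w`). [folklore] -/
theorem root_identity {W : (UnitAddTorus (Fin 3)) → (EuclideanSpace ℝ (Fin 3))} (hW : W =ᵐ[volume] vfield) {w : (UnitAddTorus (Fin 3)) → (EuclideanSpace ℝ (Fin 3))} (hw : IsSmooth w)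
    (hwd : IsDivFree w) :
    (∫ x, ⟪fK x, w x⟫_ℝ) + (∫ x, ⟪W x, Torus.fderiv w x drift⟫_ℝ) +
      (∫ x, ⟪Torus.fderiv w x (W x), W x⟫_ℝ) = 0 := by
  have hv := isSmooth_vfield
  have e1 : ∫ x, ⟪W x, Torus.fderiv w x drift⟫_ℝ = ∫ x, ⟪vfield x, Torus.fderiv w x drift⟫_ℝ :=
    integral_congr_ae (by filter_upwards [hW] with x hx; rw [hx])
  have e2 : ∫ x, ⟪Torus.fderiv w x (W x), W x⟫_ℝ = ∫ x, ⟪Torus.fderiv w x (vfield x), vfield x⟫_ℝ :=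
    integral_congr_ae (by filter_upwards [hW] with x hx; rw [hx])
  -- antisymmetry of the trilinear form, twice
  have ibp1 : ∫ x, ⟪Torus.fderiv w x (vfield x), vfield x⟫_ℝ = -∫ x, ⟪Torus.convect vfield vfield x, w x⟫_ℝ := by
    have h := Torus.integral_inner_convect_eq_neg hv isDivFree_vfield hw hv
    change ∫ x, ⟪Torus.convect vfield w x, vfield x⟫_ℝ = _
    rw [h]
    congr 1
    exact integral_congr_ae (ae_of_all _ fun x => real_inner_comm _ _)
  have ibp2 : ∫ x, ⟪vfield x, Torus.fderiv w x drift⟫_ℝ = -∫ x, ⟪Torus.fderiv vfield x drift, w x⟫_ℝ := by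
    have h := Torus.integral_inner_convect_eq_neg (isSmooth_const drift) (isDivFree_const_field drift) hv hw
    change ∫ x, ⟪Torus.fderiv vfield x drift, w x⟫_ℝ = -∫ x, ⟪vfield x, Torus.fderiv w x drift⟫_ℝ at h
    linarith
  -- the classical equation tested against `w`
  have hDm : IsSmooth fun x => Torus.fderiv vfield x drift := (isSmooth_const drift).convect hv
  have mom : ∫ x, ⟪fK x, w x⟫_ℝ = (∫ x, ⟪Torus.convect vfield vfield x, w x⟫_ℝ) +
      ∫ x, ⟪Torus.fderiv vfield x drift, w x⟫_ℝ := by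
    have hp := integral_inner_gradient_eq_zero_of_isDivFree hw isSmooth_pres hwd
    have i1 : Integrable (fun x => ⟪Torus.convect vfield vfield x, w x⟫_ℝ) volume := ((hv.convect hv).inner hw).integrable
    have i2 : Integrable (fun x => ⟪Torus.fderiv vfield x drift, w x⟫_ℝ) volume := (hDm.inner hw).integrable
    have i3 : Integrable (fun x => ⟪Torus.gradient pres x, w x⟫_ℝ) volume := (isSmooth_pres.gradient.inner hw).integrable
    have i12 : Integrable (fun x => ⟪Torus.convect vfield vfield x, w x⟫_ℝ + ⟪Torus.fderiv vfield x drift, w x⟫_ℝ)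
        volume := i1.add i2
    calc ∫ x, ⟪fK x, w x⟫_ℝ
        = ∫ x, (⟪Torus.convect vfield vfield x, w x⟫_ℝ + ⟪Torus.fderiv vfield x drift, w x⟫_ℝ +
            ⟪Torus.gradient pres x, w x⟫_ℝ) := by
          refine integral_congr_ae (ae_of_all _ fun x => ?_)
          show ⟪fK x, w x⟫_ℝ = _
          rw [← crossedShear_momentum x, inner_add_left, inner_add_left]
      _ = (∫ x, ⟪Torus.convect vfield vfield x, w x⟫_ℝ) + (∫ x, ⟪Torus.fderiv vfield x drift, w x⟫_ℝ) +
            ∫ x, ⟪Torus.gradient pres x, w x⟫_ℝ := by rw [integral_add i12 i3, integral_add i1 i2]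
      _ = _ := by rw [hp, add_zero]
  rw [e1, e2, ibp1, ibp2, mom]
  ring

/-- The defect integrals of a state represented by `v` are those of `v` (translation invariance of the
Haar measure transports the a.e. equality). [folklore] -/
theorem integral_increment_sq_congr {W : (UnitAddTorus (Fin 3)) → (EuclideanSpace ℝ (Fin 3))} (hW : W =ᵐ[volume] vfield) (h : (UnitAddTorus (Fin 3))) :
    ∫ x, ‖W (x + h) - W x‖ ^ 2 = ∫ x, ‖vfield (x + h) - vfield x‖ ^ 2 := by
  have hsh : (fun x => W (x + h)) =ᵐ[volume] fun x => vfield (x + h) :=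
    (measurePreserving_add_right volume h).quasiMeasurePreserving.ae_eq_comp hW
  refine integral_congr_ae ?_
  filter_upwards [hW, hsh] with x hx hxh
  rw [hx, hxh]

/-- **The state is not planar**: for every state represented by `v` and every `p ∈ ℤ² ∖ 0`,
`½∫₀¹∫‖W(· + s p̂) − W‖² ≥ c_K²/16`. [folklore] -/
theorem defect_state_ge {W : (UnitAddTorus (Fin 3)) → (EuclideanSpace ℝ (Fin 3))} (hW : W =ᵐ[volume] vfield) (p : {p : ℤ × ℤ // p ≠ 0}) :
    cK ^ 2 / 16 ≤ (1 / 2 : ℝ) * ∫ s in (0 : ℝ)..1, ∫ x, ‖W (x + Literature.Analysis.FluidPDE.toTorus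
      (fun i => s * (![((p.1.1 : ℤ) : ℝ), 0, ((p.1.2 : ℤ) : ℝ)] : Fin 3 → ℝ) i)) - W x‖ ^ 2 := by
  have hp : (p.1.1, p.1.2) ≠ (0, 0) := by
    obtain ⟨⟨a, b⟩, hab⟩ := p
    simpa using hab
  have h := defect_vfield_ge p.1.1 p.1.2 hp
  simp_rw [integral_increment_sq_congr hW]
  exact h

/-- `c_K²/16 > 0`. [folklore] -/
theorem cK_sq_div_pos : 0 < cK ^ 2 / 16 := by
  have h1 : cK ^ 2 = 1 / (16 * π ^ 2) := by unfold cK; field_simp; ring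
  rw [h1]
  positivity

/-! ## §11 The kills -/

/-- **KILL: `RootsPlanar` (stmt-AnomalousDissipation-28522, route SteadyCoherentFraction rank 3) is FALSE.**
CLASS: refuted-SUBSTANTIVE. WITNESS: the crossed-shear / reciprocal-shear root of Euler + drift + f_K on T³ — census
family `v = (A cos4πx₁ · r(x₂), (ε cos4πx₀ + c₁)/r(x₂) − m₁, 0)`, `m = (0, m₁, 0)` at the member `A = 1`, `ε = 1`,
`1/r = ρ = 1 + ½cos(2πx₂)`, `c₁ = m₁ = c_K = −1/(4π)` (`vfield`, `drift` of `…WitnessDefs`): a smooth finite-enstrophy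
cylindrical steady root (`root_identity`) whose planar-symmetry defect is `≥ c_K²/16 = 1/(256π²)` in EVERY horizontal
lattice direction (`defect_state_ge`), so the infimum in the conclusion is not `0`. NO CHEAP REPAIR: the family passes
through the laminar root (non-planar roots `L²`-accumulate at the laminar state — the aside LaminarIsolation is false,
E31/E28b) and has members of arbitrarily small enstrophy at large drift, so neither a laminar-proximity nor a
small-enstrophy side condition rescues the Liouville claim; the finite-Fourier-type repair is the separate item
`FiniteModeRootsPlanar` (27870), untouched (the witness has infinite type). Barrier-candidate: «reciprocal-shear
modulation» (pressure-sharing stacks `(A(x₁,x₂), B(x₀,x₂), 0)` defeat inviscid planar rigidity at f_K). Credit: census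
memo NONPLANAR-ROOT-FAMILY.md d24a2b45f95a45a5 (decomp-ad STATUS 2026-08-30T23:16:46Z, crit-certified on paper l.1223) and
the independent lens-4 g22 kernel spec CrossedShearRoots.lean a0e7b9766f80b4f9. [folklore] -/
theorem not_rootsPlanar :
    ¬ Summit.AnomalousDissipation.AnomalousDissipation.Theses.SteadyCoherentFraction.RootsPlanar := by
  intro hP
  obtain ⟨W, hW, hV⟩ := exists_state
  have hfin : Literature.Analysis.FunctionSpaces.Torus.eGradNormSq
      ((W : Lp (EuclideanSpace ℝ (Fin 3)) 2 (volume : Measure (UnitAddTorus (Fin 3)))) : (UnitAddTorus (Fin 3)) → (EuclideanSpace ℝ (Fin 3))) < ⊤ :=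
    Literature.Analysis.FluidPDE.eGradNormSq_lt_top_of_memSobolev_one hV.2
  have hroot := hP drift (Literature.Analysis.FunctionSpaces.Torus.eGradNormSq
      ((W : Lp (EuclideanSpace ℝ (Fin 3)) 2 (volume : Measure (UnitAddTorus (Fin 3)))) : (UnitAddTorus (Fin 3)) → (EuclideanSpace ℝ (Fin 3)))).toReal W (ENNReal.ofReal_toReal hfin.ne).ge
    (fun Φ => root_identity hW (Torus.CylindricalTest.isSmooth_grad_holds Φ W)
      (Torus.CylindricalTest.isDivFree_grad_holds Φ W))
  haveI : Nonempty {p : ℤ × ℤ // p ≠ 0} := ⟨⟨(1, 0), by simp⟩⟩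
  have hge := le_ciInf fun p => defect_state_ge hW p
  rw [hroot] at hge
  exact absurd hge (not_le.mpr cK_sq_div_pos)

end Summit.AnomalousDissipation.AnomalousDissipation.Theorems.CrossedShearRoot

end
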